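import Summits.CriticalPhenomena.PercolationContinuityZ3.Theorems.PercNearOneGluingNoHeavyLowerTailSahiClassTCoreReduction
import Mathlib.Tactic.Linarith
import Mathlib.Tactic.Ring
import HarnessLib

/-!
# `NoHeavyLowerTail` (crux stmt-CriticalPhenomena-4575), P2 — the open core, ENGINE FORM: the core step receives `C_3` for all triples of smaller total
# essential support

Support file (seat `prim-masterthm-p2`, gen 14; `--supports stmt-CriticalPhenomena-4575`).  No definition, no `sorry`, standard axioms.
The induction of `…SahiClassTCoreReduction` (class T / implied / required / private inheritance, on the total essential support `Σ_j |esupp U_j|`) with the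
induction hypothesis EXPOSED to the core step: `sahiE_three_nonneg_of_core_step` — if for every CORE triple `U` (a coordinate essential to all three members; no
canalyzing and no private essential coordinate) one derives `E_3(μ_p; 1_U) ≥ 0` from `C_3` of all increasing triples of strictly smaller total essential support, then
`C_3` holds for every triple on the cube.  Every structural criterion that produces ONE "good" essential coordinate on core triples (Bernstein-good `mixC ≥ 0`;
bnk-2's TOP law `T⁺ ≥ 0`; two independent `1`-sections, …) plugs into this engine — see `…SahiClassTTwoLevel`.  HONEST FRAMING: a reduction. [this work]
-/

noncomputable section

open scoped Classical

namespace Summit.CriticalPhenomena.PercolationContinuityZ3.Theorems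

namespace SahiClassTCube

open Finset Function
open Literature.Combinatorics.Sahi2008
open Literature.Probability.Percolation.DecisionTree (ind ind_of_mem ind_of_not_mem ind_nonneg)
open Literature.Probability.LatticeModels.Kahn2022 (Affects)

variable {κ : Type} [Fintype κ]

/-- **THE CORE INDUCTION, ENGINE FORM** (fixed cube `κ`, fixed parameter `p`): the core step may use `C_3` for every increasing triple of strictly smaller
total essential support. [this work] -/
theorem sahiE_three_nonneg_of_core_step (p : κ → unitInterval)
    (hcore : ∀ U : Fin 3 → Set (Set κ), (∀ j, IsUpperSet (U j)) →
      (∃ x, x ∈ esupp (U 0) ∧ x ∈ esupp (U 1) ∧ x ∈ esupp (U 2)) →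
      (∀ j x, x ∈ esupp (U j) → ¬ ({ω : Set κ | x ∈ ω} ⊆ U j) ∧ ¬ (U j ⊆ {ω : Set κ | x ∈ ω})) →
      (∀ j x, x ∈ esupp (U j) → ∃ j', j' ≠ j ∧ x ∈ esupp (U j')) →
      (∀ W : Fin 3 → Set (Set κ), (∀ j, IsUpperSet (W j)) → (∑ i, (esupp (W i)).card) < (∑ i, (esupp (U i)).card) →
        0 ≤ sahiE (bernoulliWeight p) 3 (fun j => ind (W j))) →
      0 ≤ sahiE (bernoulliWeight p) 3 (fun j => ind (U j)))
    (U : Fin 3 → Set (Set κ)) (hU : ∀ j, IsUpperSet (U j)) :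
    0 ≤ sahiE (bernoulliWeight p) 3 (fun j => ind (U j)) := by
  suffices key : ∀ (N : ℕ) (V : Fin 3 → Set (Set κ)), (∑ i, (esupp (V i)).card) ≤ N → (∀ j, IsUpperSet (V j)) →
      0 ≤ sahiE (bernoulliWeight p) 3 (fun j => ind (V j)) from key _ U le_rfl hU
  intro N
  induction N with
  | zero =>
    -- no essential coordinates at all: class T
    intro V hN hV
    refine sahiE_three_nonneg_of_classT' V hV (fun x hx => ?_) p
    have h0 : (esupp (V 0)).card = 0 := by
      have := Finset.single_le_sum (f := fun i => (esupp (V i)).card) (fun i _ => Nat.zero_le _) (Finset.mem_univ (0 : Fin 3))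
      omega
    rw [Finset.card_eq_zero] at h0
    simpa [h0] using hx.1
  | succ N ih =>
    intro V hN hV
    -- sections and their support
    have hVsec : ∀ (x : κ) (b : Bool) (j : Fin 3), IsUpperSet (secAt x b (V j)) := fun x b j => isUpperSet_secAt x b (hV j)
    have ihsec : ∀ (x : κ) (b : Bool) (j : Fin 3), x ∈ esupp (V j) →
        0 ≤ sahiE (bernoulliWeight p) 3 (fun i => ind (secAt x b (V i))) := by
      intro x b j hx
      refine ih (fun i => secAt x b (V i)) ?_ (hVsec x b)
      have := sum_card_esupp_secAt_lt V hV hx b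
      omega
    -- the same for a re-indexed triple
    have ihsecσ : ∀ (σ : Equiv.Perm (Fin 3)) (x : κ) (b : Bool) (j : Fin 3), x ∈ esupp (V (σ j)) →
        0 ≤ sahiE (bernoulliWeight p) 3 (fun i => ind (secAt x b (V (σ i)))) := by
      intro σ x b j hx
      rw [sahiE_three_ind_comp_perm (bernoulliWeight p) σ (fun i => secAt x b (V i))]
      exact ihsec x b (σ j) hx
    by_cases hT : ∃ x, x ∈ esupp (V 0) ∧ x ∈ esupp (V 1) ∧ x ∈ esupp (V 2)
    swap
    · -- class T
      push Not at hT
      exact sahiE_three_nonneg_of_classT' V hV (fun x hx => hT x hx.1 hx.2.1 hx.2.2) p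
    by_cases himp : ∃ (j : Fin 3) (x : κ), x ∈ esupp (V j) ∧ {ω : Set κ | x ∈ ω} ⊆ V j
    · -- an implied coordinate: inherit from the `0`-sections
      obtain ⟨j, x, hx, hsub⟩ := himp
      let σ : Equiv.Perm (Fin 3) := Equiv.swap 0 j
      have hσ : σ 0 = j := by simp [σ]
      rw [← sahiE_three_ind_comp_perm (bernoulliWeight p) σ V]
      have h := SahiCoordinateGluing.sahiE_three_nonneg_of_coordEvent_subset_member p x (hV (σ 0)) (hV (σ 1)) (hV (σ 2))
        (by rw [hσ]; exact hsub) (by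
          rw [Pointwise.ind_vec3, ← Pointwise.ind_vec3, vec3_eta (fun i => secAt x false (V (σ i)))]
          exact ihsecσ σ x false 0 (by rw [hσ]; exact hx))
      rw [vec3_eta (fun i => V (σ i))] at h
      exact h
    by_cases hreq : ∃ (j : Fin 3) (x : κ), x ∈ esupp (V j) ∧ V j ⊆ {ω : Set κ | x ∈ ω}
    · -- a required coordinate: inherit from the `1`-sections
      obtain ⟨j, x, hx, hsub⟩ := hreq
      let σ : Equiv.Perm (Fin 3) := Equiv.swap 2 j
      have hσ : σ 2 = j := by simp [σ]
      rw [← sahiE_three_ind_comp_perm (bernoulliWeight p) σ V]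
      have hCe : ∀ b : Bool, secAt x b (secAt x true (V (σ 2))) = secAt x true (V (σ 2)) := fun b => Pointwise.secAt_secAt_same x b true _
      have h := Pointwise.sahiE_three_interCoord_nonneg p x (hV (σ 0)) (hV (σ 1)) (hVsec x true (σ 2)) hCe (by
        rw [Pointwise.ind_vec3, ← Pointwise.ind_vec3, vec3_eta (fun i => secAt x true (V (σ i)))]
        exact ihsecσ σ x true 2 (by rw [hσ]; exact hx))
      rw [secAt_true_inter_coordEvent_of_subset x (by rw [hσ]; exact hsub), vec3_eta (fun i => V (σ i))] at h
      exact h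
    by_cases hpriv : ∃ (j : Fin 3) (x : κ), x ∈ esupp (V j) ∧ ∀ j', j' ≠ j → x ∉ esupp (V j')
    · -- a private coordinate: the fibre is affine, both sections are smaller
      obtain ⟨j, x, hx, hnot⟩ := hpriv
      let σ : Equiv.Perm (Fin 3) := Equiv.swap 0 j
      have hσ : σ 0 = j := by simp [σ]
      rw [← sahiE_three_ind_comp_perm (bernoulliWeight p) σ V]
      have hVσ : ∀ i, IsUpperSet (V (σ i)) := fun i => hV (σ i)
      rw [Pointwise.sahiE_three_bernstein_secAt x (fun i => V (σ i)) hVσ p]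
      have hfree : ∀ i : Fin 3, i ≠ 0 → ∀ b : Bool, secAt x b (V (σ i)) = V (σ i) := by
        intro i hi b
        have hne : σ i ≠ j := by
          intro h'
          apply hi
          have : σ i = σ 0 := by rw [h', hσ]
          exact σ.injective this
        exact secAt_eq_self_of_not_affects (hV (σ i)) (fun ha => hnot (σ i) hne (mem_esupp.2 ha)) b
      have h1 : secAt x true (V (σ 1)) = secAt x false (V (σ 1)) := by rw [hfree 1 (by decide), hfree 1 (by decide)]
      have h2 : secAt x true (V (σ 2)) = secAt x false (V (σ 2)) := by rw [hfree 2 (by decide), hfree 2 (by decide)]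
      obtain ⟨e1, e2⟩ := mixC_eq_of_sections_eq (bernoulliWeight p) (fun i => secAt x false (V (σ i))) (fun i => secAt x true (V (σ i))) h1 h2
      rw [e1, e2]
      have E0 := ihsecσ σ x false 0 (by rw [hσ]; exact hx)
      have E1 := ihsecσ σ x true 0 (by rw [hσ]; exact hx)
      have ht0 : 0 ≤ (p x : ℝ) := (p x).2.1
      have ht1 : 0 ≤ 1 - (p x : ℝ) := sub_nonneg.2 (p x).2.2
      have hm1 : 0 ≤ 2 * sahiE (bernoulliWeight p) 3 (fun i => ind (secAt x false (V (σ i))))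
          + sahiE (bernoulliWeight p) 3 (fun i => ind (secAt x true (V (σ i)))) := by linarith
      have hm2 : 0 ≤ sahiE (bernoulliWeight p) 3 (fun i => ind (secAt x false (V (σ i))))
          + 2 * sahiE (bernoulliWeight p) 3 (fun i => ind (secAt x true (V (σ i)))) := by linarith
      have a0 := mul_nonneg (pow_nonneg ht1 3) E0
      have a1 := mul_nonneg (mul_nonneg ht0 (pow_nonneg ht1 2)) hm1
      have a2 := mul_nonneg (mul_nonneg (pow_nonneg ht0 2) ht1) hm2
      have a3 := mul_nonneg (pow_nonneg ht0 3) E1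
      linarith
    -- otherwise the triple is CORE: hand the induction hypothesis to the core step
    push Not at himp hreq hpriv
    exact hcore V hV hT (fun j x hx => ⟨himp j x hx, hreq j x hx⟩) (fun j x hx => by
      obtain ⟨j', hj', hxj'⟩ := hpriv j x hx
      exact ⟨j', hj', by simpa using hxj'⟩) (fun W hW hlt => ih W (by omega) hW)


end SahiClassTCube

end Summit.CriticalPhenomena.PercolationContinuityZ3.Theorems
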